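import Literature.MathematicalPhysics.QuantumLattice.DWaveSourceTwistedFlipInvariance
import Literature.MathematicalPhysics.QuantumLattice.HubbardTTPrimeWindowCertificateAbstractState
import HarnessLib

/-!
# Pair-sourced `t–t'` window certificates with flip-twisted symmetry defects, read in the CLASS OF ALL
# TRANSLATION-INVARIANT STATES: the node sentences of the cell's sourced menus as conclusions of a theorem

Topic `Literature/MathematicalPhysics/QuantumLattice` (namespace = path); cell `hubbard-cq`, seat `hubbard-cq-obsth-1`.
The cell's pinning-field (PC-a) menus (hubbard-cq-pilot-1 and hubbard-cq-pilot-2, engine obsb ≥ 0.3.0, union basis `b2_5x5_c3b4_s37_gbT`) certify,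
for the Koma–Tasaki sourced `t–t'` Hubbard model `Φ(1,t',U) − μn − h P_d`, sentences of the shape «for every
translation-invariant state `σ` of the CAR algebra over `ℤ² × {↑,↓}` of density `n` [with `e^{src}_h(σ) ≤ u`]:
`e^{src}_h(σ) ≥ ℓ`» (energy floors: jobs S/E/G/D) or «`√2·Re σ(P₀^d) ≤ M̃`» (response ceilings: M1–M5, L1–L3) — the node
shapes `cert_pin1_*` / `cert_pin2menuA0_*` of `Summits/Ventures/CertifiedManyBodySolver/Certificates/`. The certificate is a
dual identity in a window algebra `𝔄_{Λ'}` whose symmetry rows are the sixteen-element gauge-TWISTED `D₄ × flip`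
identifications («WLOG by averaging» in the engine's words; second-reader PASS on paper, hubbard-cq-obsth-3 2026-08-27).
This file makes the sentence a THEOREM about the identity:

* §1 `re_expect_ge_of_sourced_certificate_TI_rows` — ONE state, every row explicit: if
  `Xw − c·1 − Σ_σ μ_σ (n_{0σ} − ν·1) − κ⁺ (u·1 − Γ E^{src}) − κ⁻ (Γ E^{tt'} − ℓ·1) = Σ Λₐᵦ Oₐᴴ O_b + D + (Σₘ dₘ (Vₘᴴ − Vₘ) + Σₖ aₖ Wₖ)`
  in `𝔄_{Λ'}` (`Λm ⪰ 0`, `D` any operator — the symmetry-defect block —, real `dₘ`, ladder words `Wₖ`), then for EVERY state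
  `ω`: `c − Σ‖aₖ‖ + Σ_σ μ_σ (Re ω(n_{0σ}) − ν) + κ⁺ (u − e^{src}(ω)) + κ⁻ (e^{tt'}(ω) − ℓ) + Re ω(D) ≤ Re ω(Xw)`
  (`E^{src} = meanEnergyObs` of `hubbardTTPrimeSourcedInteraction 1 t' U μ dWaveFormFactor h`, `e^{src}(ω) = Re ω(Γ E^{src})`).
* §2 `IsTranslationInvariant.re_sum_twistedFlipAct_expect_ge_of_sourced_certificate` — the ORBIT form: with `D` the
  flip-twisted defect block `Σₗ bₗ • (φₗ • Γ(incl)(Γ(d4Emb γₗ wₗ Λ)(F^{fₗ} Wₗ)) − Γ(incl) Wₗ)` of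
  `DWaveSourceNNNHoppingTwistedFlipWindowCertificate` (§8 of the cell's consumer grammar), the cap row discharged by
  `κ⁺ e^{src}(ω) ≤ κ⁺ u` and the floor row by `κ⁻ ℓ ≤ κ⁻ e^{tt'}(σ)` on the translation-invariant states of density `ρ(ω)`:
  `c − Σ‖aₖ‖ + (Σ_σ μ_σ)(ρ(ω)/2 − ν) ≤ (1/32) Σ_g Re (α_g ω)(Xw)` for EVERY translation-invariant `ω` — the defects cancel
  in the orbit sum (`sum_twistedFlipAct_expect_twistedFlipDefect_eq_zero`), the spin densities balance, `e^{src}` and `e^{tt'}` are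
  orbit invariants (`DWaveSourceTwistedFlipInvariance`).
* §3 THE NODE SHAPES: energy objective `Xw = Γ E^{src}` ⇒ `c − Σ‖aₖ‖ + (Σμ)(ρ(ω)/2 − ν) ≤ e^{src}_h(ω)`
  (`…le_meanEnergy_sourced_of_twistedFlip_certificate`); pair objective `Xw = ∓(Γ P₀^d + (Γ P₀^d)ᴴ)` ⇒
  `2 Re ω(P₀^d) ≤ −(c − Σ‖aₖ‖ + (Σμ)(ρ(ω)/2 − ν))` (`…two_mul_re_expect_localPairAt_le_of_twistedFlip_certificate`, MAX) and
  `c − Σ‖aₖ‖ + (Σμ)(ρ(ω)/2 − ν) ≤ 2 Re ω(P₀^d)` (MIN), for every translation-invariant `ω` (any density; filling rows read `ρ(ω)`).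

HONEST FRAMING: soundness theorems; no certificate, no number, no order parameter, no phase word. A finite-`h` response bound
is a response, never an order parameter (cell wording W1). NOT covered: eom/KKT rows (ground states only — torus readers
`DWaveSourceNNNHoppingTwistedFlipWindowCertificateKKT`), `S^z`-charged word rows (absent from the menus' problems: the engine's
`Sz_only` mode never generates an `S^z`-charged word). Everything is PROVED; no definition, no named fact, no `sorry`.
Tree search: REUSED `le_re_map_of_certificate_residual`, `neg_sum_norm_le_re_map_sum`, `neg_norm_le_re_mul_expect_ladderWord`,
`re_ofReal_mul_expect_conjTranspose_sub_self`, `sum_twistedFlipAct_expect_twistedFlipDefect_eq_zero`, `sum_twistedFlipAct_re_expect_nAt_zero`,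
`IsTranslationInvariant.(sum_)meanEnergy_hubbardTTPrime(Sourced)_twistedFlipAct`, `sum_re_expect_localPairAt_dWave_twistedFlipAct`,
`twistedFlipAct_density`, `expect_conjTranspose`; `lean search 'TI_rows|twistedFlip_certificate'`: nothing.

References: J. Wang et al., PRX 14 (2024) 031006, §III (energy-constrained relaxations; weak duality) [cite: WangEtAl2024, §III];
X. Han, arXiv:2006.06002 §3 (symmetry reduction) [cite: Han2020Bootstrap, §3]; T. Koma, H. Tasaki, J. Stat. Phys. 76 (1994) 745, §1
(pair field, response) [cite: KomaTasaki1994, §1]; O. Bratteli, D. W. Robinson, *OAQSM 1* (1987) §4.3.1 [cite: BratteliRobinsonI1987, §4.3.1].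
-/

noncomputable section

namespace Literature.MathematicalPhysics.QuantumLattice

open Matrix Finset Complex HubbardWave0 Literature.Probability.LatticeModels
open Literature.MathematicalPhysics.QuantumManyBody.StateRelaxation
open scoped ComplexOrder BigOperators

namespace InfVolFermionState

/-! ## §1 One state, every row explicit -/

/-- **The sourced window certificate read in ONE abstract state, every row explicit.** Identity in `𝔄_{Λ'}`:
`Xw − c·1 − Σ_σ μ_σ (n_{0σ} − ν·1) − κ⁺ (u·1 − Γ E^{src}) − κ⁻ (Γ E^{tt'} − ℓ·1) = Σ Λₐᵦ Oₐᴴ O_b + D + (Σₘ dₘ (Vₘᴴ − Vₘ) + Σₖ aₖ Wₖ)`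
(`Λm ⪰ 0`; `D` arbitrary; `dₘ` real; `Wₖ` ladder words). Then for every state `ω`:
`c − Σ‖aₖ‖ + Σ_σ μ_σ (Re ω(n_{0σ}) − ν) + κ⁺ (u − e^{src}(ω)) + κ⁻ (e^{tt'}(ω) − ℓ) + Re ω(D) ≤ Re ω(Xw)` — positivity on the Gram
part, Hermiticity on the anti-Hermitian parts, contractivity on the words; nothing else. [cite: WangEtAl2024, §III] -/
theorem re_expect_ge_of_sourced_certificate_TI_rows (ω : InfVolFermionState 2) (t' U μ h : ℝ)
    {Λ' : Finset (Site 2)} (h0 : thicken ({0} : Finset (Site 2)) 1 ⊆ Λ') (hz : (0 : Site 2) ∈ Λ')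
    (Xw D : FermionOp Λ') (κp κm u lo : ℝ) (μc : Fin 2 → ℝ) (ν : ℝ)
    {m : Type*} [Fintype m] [DecidableEq m] {Λm : Matrix m m ℂ} (hΛm : Λm.PosSemidef) (O : m → FermionOp Λ')
    {δ : Type*} (ah : Finset δ) (dc : δ → ℝ) (V : δ → FermionOp Λ')
    {κ'' : Type*} (w : Finset κ'') (a : κ'' → ℂ) (word : κ'' → List (Orb (PolySite Λ') × Bool)) {c : ℝ}
    (hcert : Xw - (c : ℂ) • (1 : FermionOp Λ') -
        ∑ σ : Fin 2, ((μc σ : ℝ) : ℂ) • (nAt 0 hz σ - ((ν : ℝ) : ℂ) • (1 : FermionOp Λ')) -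
        ((κp : ℝ) : ℂ) • (((u : ℝ) : ℂ) • (1 : FermionOp Λ') -
          fermionEmbed (PolySite.incl h0) ((hubbardTTPrimeSourcedInteraction 1 t' U μ dWaveFormFactor h).meanEnergyObs 1)) -
        ((κm : ℝ) : ℂ) • (fermionEmbed (PolySite.incl h0) ((hubbardTTPrimeFermionInteraction 1 t' U).meanEnergyObs 1) -
          ((lo : ℝ) : ℂ) • (1 : FermionOp Λ')) =
      gramForm Λm O + D + (∑ m' ∈ ah, ((dc m' : ℝ) : ℂ) • ((V m')ᴴ - V m') + ∑ k ∈ w, a k • ladderWord (word k))) :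
    c - ∑ k ∈ w, ‖a k‖ + ∑ σ : Fin 2, μc σ * ((ω.expect Λ' (nAt 0 hz σ)).re - ν) +
        κp * (u - ω.meanEnergy (hubbardTTPrimeSourcedInteraction 1 t' U μ dWaveFormFactor h) 1) +
        κm * (ω.meanEnergy (hubbardTTPrimeFermionInteraction 1 t' U) 1 - lo) + (ω.expect Λ' D).re ≤
      (ω.expect Λ' Xw).re := by
  have hpos : ∀ A : FermionOp Λ', 0 ≤ ω.expect Λ' (star A * A) := fun A => by
    rw [Matrix.star_eq_conjTranspose]; exact ω.expect_nonneg Λ' A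
  have hah : (ω.expect Λ' (∑ m' ∈ ah, ((dc m' : ℝ) : ℂ) • ((V m')ᴴ - V m'))).re = 0 := by
    rw [map_sum, Complex.re_sum]
    refine Finset.sum_eq_zero fun m' _ => ?_
    rw [map_smul, smul_eq_mul]
    exact ω.re_ofReal_mul_expect_conjTranspose_sub_self Λ' (dc m') (V m')
  have hr : -(∑ k ∈ w, ‖a k‖) ≤ (ω.expect Λ'
      (∑ m' ∈ ah, ((dc m' : ℝ) : ℂ) • ((V m')ᴴ - V m') + ∑ k ∈ w, a k • ladderWord (word k))).re := by
    rw [map_add, Complex.add_re, hah, zero_add]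
    exact neg_sum_norm_le_re_map_sum w (ω.expect Λ') a (fun k => ladderWord (word k))
      fun k _ => ω.neg_norm_le_re_mul_expect_ladderWord Λ' (a k) (word k)
  -- move every linear row and the defect block to the objective side
  have hcert' : (Xw - ∑ σ : Fin 2, ((μc σ : ℝ) : ℂ) • (nAt 0 hz σ - ((ν : ℝ) : ℂ) • (1 : FermionOp Λ')) -
        ((κp : ℝ) : ℂ) • (((u : ℝ) : ℂ) • (1 : FermionOp Λ') -
          fermionEmbed (PolySite.incl h0) ((hubbardTTPrimeSourcedInteraction 1 t' U μ dWaveFormFactor h).meanEnergyObs 1)) -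
        ((κm : ℝ) : ℂ) • (fermionEmbed (PolySite.incl h0) ((hubbardTTPrimeFermionInteraction 1 t' U).meanEnergyObs 1) -
          ((lo : ℝ) : ℂ) • (1 : FermionOp Λ')) - D) - (c : ℂ) • (1 : FermionOp Λ') =
      gramForm Λm O + 0 + (∑ m' ∈ ah, ((dc m' : ℝ) : ℂ) • ((V m')ᴴ - V m') + ∑ k ∈ w, a k • ladderWord (word k)) := by
    rw [add_zero, ← sub_eq_iff_eq_add'.2 hcert]
    abel
  have hmain := le_re_map_of_certificate_residual (ω.expect Λ') hpos (ω.expect_one Λ') hΛm O (map_zero _) hr hcert'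
  have hlhs : (ω.expect Λ' (Xw - ∑ σ : Fin 2, ((μc σ : ℝ) : ℂ) • (nAt 0 hz σ - ((ν : ℝ) : ℂ) • (1 : FermionOp Λ')) -
        ((κp : ℝ) : ℂ) • (((u : ℝ) : ℂ) • (1 : FermionOp Λ') -
          fermionEmbed (PolySite.incl h0) ((hubbardTTPrimeSourcedInteraction 1 t' U μ dWaveFormFactor h).meanEnergyObs 1)) -
        ((κm : ℝ) : ℂ) • (fermionEmbed (PolySite.incl h0) ((hubbardTTPrimeFermionInteraction 1 t' U).meanEnergyObs 1) -
          ((lo : ℝ) : ℂ) • (1 : FermionOp Λ')) - D)).re =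
      (ω.expect Λ' Xw).re - ∑ σ : Fin 2, μc σ * ((ω.expect Λ' (nAt 0 hz σ)).re - ν) -
        κp * (u - ω.meanEnergy (hubbardTTPrimeSourcedInteraction 1 t' U μ dWaveFormFactor h) 1) -
        κm * (ω.meanEnergy (hubbardTTPrimeFermionInteraction 1 t' U) 1 - lo) - (ω.expect Λ' D).re := by
    simp only [map_sub, map_sum, map_smul, smul_eq_mul, Complex.sub_re, Complex.re_sum, Complex.re_ofReal_mul,
      ω.expect_one, mul_one, Complex.ofReal_re, ω.compatible h0, InfVolFermionState.meanEnergy]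
  rw [hlhs] at hmain
  linarith

/-! ## §2 The orbit form: every translation-invariant state -/

variable {ω : InfVolFermionState 2}

/-- **Sourced window certificate with FLIP-TWISTED defects ⇒ bound on the orbit mean of the objective in EVERY
translation-invariant state.** The identity of `re_expect_ge_of_sourced_certificate_TI_rows` with the defect block
`D = Σₗ bₗ • (φₗ • Γ(incl)(Γ(d4Emb γₗ wₗ Λ)(F^{fₗ} Wₗ)) − Γ(incl) Wₗ)` (`Wₗ = ladderWord (yw l) ∈ 𝔄_Λ`, `φₗ = gaugePhase (twistFlipExp γₗ fₗ mₗ) Wₗ`,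
ANY `γₗ ∈ D₄`, flip bits `fₗ`, parity bits `mₗ`), the cap row discharged on `ω` (`κ⁺ e^{src}(ω) ≤ κ⁺ u`, so `κ⁺ ≥ 0` in use) and the floor row on the
translation-invariant states of density `ρ(ω)` (`κ⁻ ℓ ≤ κ⁻ e^{tt'}(σ)`), gives
`c − Σ‖aₖ‖ + (Σ_σ μ_σ)(ρ(ω)/2 − ν) ≤ (1/32) Σ_g Re (α_g ω)_{Λ'}(Xw)`, `α_g = twistedFlipAct g`: each `α_g ω` is a translation-invariant
state of density `ρ(ω)` with `e^{src}(α_g ω) = e^{src}(ω)`, the defects cancel and the spin densities balance in the orbit sum.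
[cite: WangEtAl2024, §III] [cite: Han2020Bootstrap, §3] -/
theorem IsTranslationInvariant.re_sum_twistedFlipAct_expect_ge_of_sourced_certificate (hω : ω.IsTranslationInvariant)
    (t' U μ h : ℝ) {Λ Λ' : Finset (Site 2)} (hΛ : Λ ⊆ Λ') (h0 : thicken ({0} : Finset (Site 2)) 1 ⊆ Λ') (hz : (0 : Site 2) ∈ Λ')
    (Xw : FermionOp Λ') (κp κm u lo : ℝ) (μc : Fin 2 → ℝ) (ν : ℝ)
    (hcap : κp * ω.meanEnergy (hubbardTTPrimeSourcedInteraction 1 t' U μ dWaveFormFactor h) 1 ≤ κp * u)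
    (hlo : ∀ σ : InfVolFermionState 2, σ.IsTranslationInvariant → σ.density = ω.density →
      κm * lo ≤ κm * σ.meanEnergy (hubbardTTPrimeFermionInteraction 1 t' U) 1)
    {m : Type*} [Fintype m] [DecidableEq m] {Λm : Matrix m m ℂ} (hΛm : Λm.PosSemidef) (O : m → FermionOp Λ')
    {ι : Type*} (tt : Finset ι) (γ : ι → DihedralGroup 4) (wv : ι → Site 2) (fl mt : ι → Fin 2)
    (hsh : ∀ l, d4ShiftSet (γ l) (wv l) Λ ⊆ Λ') (bb : ι → ℂ) (yw : ι → List (Orb (PolySite Λ) × Bool))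
    {δ : Type*} (ah : Finset δ) (dc : δ → ℝ) (V : δ → FermionOp Λ')
    {κ'' : Type*} (w : Finset κ'') (a : κ'' → ℂ) (word : κ'' → List (Orb (PolySite Λ') × Bool)) {c : ℝ}
    (hcert : Xw - (c : ℂ) • (1 : FermionOp Λ') -
        ∑ σ : Fin 2, ((μc σ : ℝ) : ℂ) • (nAt 0 hz σ - ((ν : ℝ) : ℂ) • (1 : FermionOp Λ')) -
        ((κp : ℝ) : ℂ) • (((u : ℝ) : ℂ) • (1 : FermionOp Λ') -
          fermionEmbed (PolySite.incl h0) ((hubbardTTPrimeSourcedInteraction 1 t' U μ dWaveFormFactor h).meanEnergyObs 1)) -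
        ((κm : ℝ) : ℂ) • (fermionEmbed (PolySite.incl h0) ((hubbardTTPrimeFermionInteraction 1 t' U).meanEnergyObs 1) -
          ((lo : ℝ) : ℂ) • (1 : FermionOp Λ')) =
      gramForm Λm O +
        ∑ l ∈ tt, bb l • (gaugePhase (twistFlipExp (γ l) (fl l) (mt l)) (yw l) •
            fermionEmbed (PolySite.incl (hsh l))
              (fermionEmbed (PolySite.d4Emb (γ l) (wv l) Λ) (spinSwapIter (fl l).val (ladderWord (yw l)))) -
          fermionEmbed (PolySite.incl hΛ) (ladderWord (yw l))) +
        (∑ m' ∈ ah, ((dc m' : ℝ) : ℂ) • ((V m')ᴴ - V m') + ∑ k ∈ w, a k • ladderWord (word k))) :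
    c - ∑ k ∈ w, ‖a k‖ + (∑ σ : Fin 2, μc σ) * (ω.density / 2 - ν) ≤
      (∑ g : TwistFlipIndex, ((ω.twistedFlipAct g).expect Λ' Xw).re) / 32 := by
  set D : FermionOp Λ' := ∑ l ∈ tt, bb l • (gaugePhase (twistFlipExp (γ l) (fl l) (mt l)) (yw l) •
      fermionEmbed (PolySite.incl (hsh l))
        (fermionEmbed (PolySite.d4Emb (γ l) (wv l) Λ) (spinSwapIter (fl l).val (ladderWord (yw l)))) -
    fermionEmbed (PolySite.incl hΛ) (ladderWord (yw l))) with hD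
  -- each transform obeys the one-state inequality
  have hg : ∀ g : TwistFlipIndex,
      c - ∑ k ∈ w, ‖a k‖ + ∑ σ : Fin 2, μc σ * (((ω.twistedFlipAct g).expect Λ' (nAt 0 hz σ)).re - ν) +
          κp * (u - (ω.twistedFlipAct g).meanEnergy (hubbardTTPrimeSourcedInteraction 1 t' U μ dWaveFormFactor h) 1) +
          κm * ((ω.twistedFlipAct g).meanEnergy (hubbardTTPrimeFermionInteraction 1 t' U) 1 - lo) +
          ((ω.twistedFlipAct g).expect Λ' D).re ≤
        ((ω.twistedFlipAct g).expect Λ' Xw).re := fun g =>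
    (ω.twistedFlipAct g).re_expect_ge_of_sourced_certificate_TI_rows t' U μ h h0 hz Xw D κp κm u lo μc ν hΛm O ah dc V
      w a word hcert
  -- the defects cancel in the orbit sum
  have hDsum : ∑ g : TwistFlipIndex, ((ω.twistedFlipAct g).expect Λ' D).re = 0 := by
    have h1 : ∑ g : TwistFlipIndex, (ω.twistedFlipAct g).expect Λ' D = 0 := by
      simp only [hD, map_sum, map_smul, smul_eq_mul]
      rw [Finset.sum_comm]
      refine Finset.sum_eq_zero fun l _ => ?_
      rw [← Finset.mul_sum, hω.sum_twistedFlipAct_expect_twistedFlipDefect_eq_zero hΛ (γ l) (wv l) (hsh l) (fl l) (mt l) (yw l),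
        mul_zero]
    rw [← Complex.re_sum, h1, Complex.zero_re]
  -- the spin densities balance
  have hNsum : ∑ g : TwistFlipIndex, ∑ σ : Fin 2, μc σ * (((ω.twistedFlipAct g).expect Λ' (nAt 0 hz σ)).re - ν) =
      32 * ((∑ σ : Fin 2, μc σ) * (ω.density / 2 - ν)) := by
    rw [Finset.sum_comm]
    have hσ : ∀ σ : Fin 2, ∑ g : TwistFlipIndex, μc σ * (((ω.twistedFlipAct g).expect Λ' (nAt 0 hz σ)).re - ν) =
        μc σ * (16 * ω.density - 32 * ν) := by
      intro σ
      rw [← Finset.mul_sum, Finset.sum_sub_distrib, ω.sum_twistedFlipAct_re_expect_nAt_zero hz σ, Finset.sum_const,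
        Finset.card_univ, card_twistFlipIndex, nsmul_eq_mul, Nat.cast_ofNat]
    rw [Finset.sum_congr rfl fun σ _ => hσ σ, ← Finset.sum_mul]
    ring
  -- the energy rows are orbit invariants / hold on the class
  have hcapg : ∀ g : TwistFlipIndex,
      0 ≤ κp * (u - (ω.twistedFlipAct g).meanEnergy (hubbardTTPrimeSourcedInteraction 1 t' U μ dWaveFormFactor h) 1) := by
    intro g
    rw [hω.meanEnergy_hubbardTTPrimeSourced_twistedFlipAct]
    linarith
  have hlog : ∀ g : TwistFlipIndex,
      0 ≤ κm * ((ω.twistedFlipAct g).meanEnergy (hubbardTTPrimeFermionInteraction 1 t' U) 1 - lo) := by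
    intro g
    have hl := hlo (ω.twistedFlipAct g) (hω.twistedFlipAct g) (twistedFlipAct_density g ω)
    linarith
  have hsum := Finset.sum_le_sum fun g (_ : g ∈ (Finset.univ : Finset TwistFlipIndex)) => hg g
  rw [Finset.sum_add_distrib, Finset.sum_add_distrib, Finset.sum_add_distrib, Finset.sum_add_distrib, hDsum, hNsum,
    Finset.sum_const, Finset.card_univ, card_twistFlipIndex, nsmul_eq_mul, Nat.cast_ofNat] at hsum
  have hp := Finset.sum_nonneg fun g (_ : g ∈ (Finset.univ : Finset TwistFlipIndex)) => hcapg g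
  have hm := Finset.sum_nonneg fun g (_ : g ∈ (Finset.univ : Finset TwistFlipIndex)) => hlog g
  rw [le_div_iff₀ (by norm_num : (0 : ℝ) < 32)]
  linarith

/-! ## §3 The node shapes -/

/-- **ENERGY NODES** (`Xw = Γ E^{src}_h`): a flip-twisted sourced window certificate on the SOURCED ENERGY DENSITY with filling
rows `μ_σ` at `ν`, an optional floor row `κ⁻ (Γ E^{tt'} − ℓ·1)` on the unsourced energy (discharged on the class of
translation-invariant states of density `ρ(ω)` — e.g. the certified `#473`-type floor — `κ⁻ = 0` if absent) and an optional cap row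
(`κ⁺`; vacuous for this objective) proves, for EVERY translation-invariant state `ω`:
`c − Σ‖aₖ‖ + (Σ_σ μ_σ)(ρ(ω)/2 − ν) ≤ e^{src}_h(ω) = ω.meanEnergy (hubbardTTPrimeSourcedInteraction 1 t' U μ dWaveFormFactor h) 1`
— the sentence of the cell's `cert_pin1_E*/G*`, `cert_pin2menuA0_*_E_*` nodes (with `ρ(ω) = n` the filling slot reads
`(Σμ)(n/2 − ν)`, `= 0` at `ν = n/2`). [cite: WangEtAl2024, §III] [cite: KomaTasaki1994, §1] -/
theorem IsTranslationInvariant.le_meanEnergy_sourced_of_twistedFlip_certificate (hω : ω.IsTranslationInvariant)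
    (t' U μ h : ℝ) {Λ Λ' : Finset (Site 2)} (hΛ : Λ ⊆ Λ') (h0 : thicken ({0} : Finset (Site 2)) 1 ⊆ Λ') (hz : (0 : Site 2) ∈ Λ')
    (κp κm u lo : ℝ) (μc : Fin 2 → ℝ) (ν : ℝ)
    (hcap : κp * ω.meanEnergy (hubbardTTPrimeSourcedInteraction 1 t' U μ dWaveFormFactor h) 1 ≤ κp * u)
    (hlo : ∀ σ : InfVolFermionState 2, σ.IsTranslationInvariant → σ.density = ω.density →
      κm * lo ≤ κm * σ.meanEnergy (hubbardTTPrimeFermionInteraction 1 t' U) 1)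
    {m : Type*} [Fintype m] [DecidableEq m] {Λm : Matrix m m ℂ} (hΛm : Λm.PosSemidef) (O : m → FermionOp Λ')
    {ι : Type*} (tt : Finset ι) (γ : ι → DihedralGroup 4) (wv : ι → Site 2) (fl mt : ι → Fin 2)
    (hsh : ∀ l, d4ShiftSet (γ l) (wv l) Λ ⊆ Λ') (bb : ι → ℂ) (yw : ι → List (Orb (PolySite Λ) × Bool))
    {δ : Type*} (ah : Finset δ) (dc : δ → ℝ) (V : δ → FermionOp Λ')
    {κ'' : Type*} (w : Finset κ'') (a : κ'' → ℂ) (word : κ'' → List (Orb (PolySite Λ') × Bool)) {c : ℝ}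
    (hcert : fermionEmbed (PolySite.incl h0) ((hubbardTTPrimeSourcedInteraction 1 t' U μ dWaveFormFactor h).meanEnergyObs 1) -
        (c : ℂ) • (1 : FermionOp Λ') -
        ∑ σ : Fin 2, ((μc σ : ℝ) : ℂ) • (nAt 0 hz σ - ((ν : ℝ) : ℂ) • (1 : FermionOp Λ')) -
        ((κp : ℝ) : ℂ) • (((u : ℝ) : ℂ) • (1 : FermionOp Λ') -
          fermionEmbed (PolySite.incl h0) ((hubbardTTPrimeSourcedInteraction 1 t' U μ dWaveFormFactor h).meanEnergyObs 1)) -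
        ((κm : ℝ) : ℂ) • (fermionEmbed (PolySite.incl h0) ((hubbardTTPrimeFermionInteraction 1 t' U).meanEnergyObs 1) -
          ((lo : ℝ) : ℂ) • (1 : FermionOp Λ')) =
      gramForm Λm O +
        ∑ l ∈ tt, bb l • (gaugePhase (twistFlipExp (γ l) (fl l) (mt l)) (yw l) •
            fermionEmbed (PolySite.incl (hsh l))
              (fermionEmbed (PolySite.d4Emb (γ l) (wv l) Λ) (spinSwapIter (fl l).val (ladderWord (yw l)))) -
          fermionEmbed (PolySite.incl hΛ) (ladderWord (yw l))) +
        (∑ m' ∈ ah, ((dc m' : ℝ) : ℂ) • ((V m')ᴴ - V m') + ∑ k ∈ w, a k • ladderWord (word k))) :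
    c - ∑ k ∈ w, ‖a k‖ + (∑ σ : Fin 2, μc σ) * (ω.density / 2 - ν) ≤
      ω.meanEnergy (hubbardTTPrimeSourcedInteraction 1 t' U μ dWaveFormFactor h) 1 := by
  have hmain := hω.re_sum_twistedFlipAct_expect_ge_of_sourced_certificate t' U μ h hΛ h0 hz _ κp κm u lo μc ν hcap hlo hΛm O
    tt γ wv fl mt hsh bb yw ah dc V w a word hcert
  have hE : ∀ g : TwistFlipIndex, ((ω.twistedFlipAct g).expect Λ'
      (fermionEmbed (PolySite.incl h0) ((hubbardTTPrimeSourcedInteraction 1 t' U μ dWaveFormFactor h).meanEnergyObs 1))).re =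
      (ω.twistedFlipAct g).meanEnergy (hubbardTTPrimeSourcedInteraction 1 t' U μ dWaveFormFactor h) 1 := fun g => by
    rw [(ω.twistedFlipAct g).compatible h0, InfVolFermionState.meanEnergy]
  simp_rw [hE, hω.sum_meanEnergy_hubbardTTPrimeSourced_twistedFlipAct] at hmain
  linarith

/-- `Re ω_{Λ'}(Γ(incl) P₀ + (Γ(incl) P₀)ᴴ) = 2 Re ω(P₀)`. [cite: KomaTasaki1994, §1] -/
theorem re_expect_fermionEmbed_localPairAt_add_conjTranspose (ω' : InfVolFermionState 2) {Λ' : Finset (Site 2)}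
    (hP : pairRegion (insert (0 : Site 2) unitSteps) 0 ⊆ Λ') :
    (ω'.expect Λ' (fermionEmbed (PolySite.incl hP) (localPairAt (insert (0 : Site 2) unitSteps) dWaveFormFactor 0) +
        (fermionEmbed (PolySite.incl hP) (localPairAt (insert (0 : Site 2) unitSteps) dWaveFormFactor 0))ᴴ)).re =
      2 * (ω'.expect (pairRegion (insert (0 : Site 2) unitSteps) 0) (localPairAt (insert (0 : Site 2) unitSteps) dWaveFormFactor 0)).re := by
  rw [map_add, ω'.expect_conjTranspose, ω'.compatible hP, Complex.add_re, Complex.star_def, Complex.conj_re, two_mul]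

/-- **RESPONSE-CEILING NODES** (`Xw = −(Γ P₀^d + (Γ P₀^d)ᴴ)`, the MAX program on the pair amplitude): a flip-twisted sourced
window certificate with filling rows, the cap row `κ⁺ (u·1 − Γ E^{src}_h)` (discharged on `ω`: `κ⁺ e^{src}_h(ω) ≤ κ⁺ u`) and the
optional floor row `κ⁻ (Γ E^{tt'} − ℓ·1)` (on the translation-invariant class of density `ρ(ω)`) proves, for every
translation-invariant `ω`: `2 Re ω(P₀^d) ≤ −(c − Σ‖aₖ‖ + (Σ_σ μ_σ)(ρ(ω)/2 − ν))` — the sentence of the cell's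
`cert_pin1_M*` / `cert_pin2menuA0_*_L*` nodes (`√2·Re σ(P₀^d) ≤ M̃` after the engine's normalisation `D₀ = √2 P₀^d`). A
finite-`h` RESPONSE ceiling, not an order parameter. [cite: KomaTasaki1994, §1] [cite: WangEtAl2024, §III] -/
theorem IsTranslationInvariant.two_mul_re_expect_localPairAt_le_of_twistedFlip_certificate (hω : ω.IsTranslationInvariant)
    (t' U μ h : ℝ) {Λ Λ' : Finset (Site 2)} (hΛ : Λ ⊆ Λ') (h0 : thicken ({0} : Finset (Site 2)) 1 ⊆ Λ') (hz : (0 : Site 2) ∈ Λ')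
    (hP : pairRegion (insert (0 : Site 2) unitSteps) 0 ⊆ Λ')
    (κp κm u lo : ℝ) (μc : Fin 2 → ℝ) (ν : ℝ)
    (hcap : κp * ω.meanEnergy (hubbardTTPrimeSourcedInteraction 1 t' U μ dWaveFormFactor h) 1 ≤ κp * u)
    (hlo : ∀ σ : InfVolFermionState 2, σ.IsTranslationInvariant → σ.density = ω.density →
      κm * lo ≤ κm * σ.meanEnergy (hubbardTTPrimeFermionInteraction 1 t' U) 1)
    {m : Type*} [Fintype m] [DecidableEq m] {Λm : Matrix m m ℂ} (hΛm : Λm.PosSemidef) (O : m → FermionOp Λ')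
    {ι : Type*} (tt : Finset ι) (γ : ι → DihedralGroup 4) (wv : ι → Site 2) (fl mt : ι → Fin 2)
    (hsh : ∀ l, d4ShiftSet (γ l) (wv l) Λ ⊆ Λ') (bb : ι → ℂ) (yw : ι → List (Orb (PolySite Λ) × Bool))
    {δ : Type*} (ah : Finset δ) (dc : δ → ℝ) (V : δ → FermionOp Λ')
    {κ'' : Type*} (w : Finset κ'') (a : κ'' → ℂ) (word : κ'' → List (Orb (PolySite Λ') × Bool)) {c : ℝ}
    (hcert : -(fermionEmbed (PolySite.incl hP) (localPairAt (insert (0 : Site 2) unitSteps) dWaveFormFactor 0) +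
          (fermionEmbed (PolySite.incl hP) (localPairAt (insert (0 : Site 2) unitSteps) dWaveFormFactor 0))ᴴ) -
        (c : ℂ) • (1 : FermionOp Λ') -
        ∑ σ : Fin 2, ((μc σ : ℝ) : ℂ) • (nAt 0 hz σ - ((ν : ℝ) : ℂ) • (1 : FermionOp Λ')) -
        ((κp : ℝ) : ℂ) • (((u : ℝ) : ℂ) • (1 : FermionOp Λ') -
          fermionEmbed (PolySite.incl h0) ((hubbardTTPrimeSourcedInteraction 1 t' U μ dWaveFormFactor h).meanEnergyObs 1)) -
        ((κm : ℝ) : ℂ) • (fermionEmbed (PolySite.incl h0) ((hubbardTTPrimeFermionInteraction 1 t' U).meanEnergyObs 1) -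
          ((lo : ℝ) : ℂ) • (1 : FermionOp Λ')) =
      gramForm Λm O +
        ∑ l ∈ tt, bb l • (gaugePhase (twistFlipExp (γ l) (fl l) (mt l)) (yw l) •
            fermionEmbed (PolySite.incl (hsh l))
              (fermionEmbed (PolySite.d4Emb (γ l) (wv l) Λ) (spinSwapIter (fl l).val (ladderWord (yw l)))) -
          fermionEmbed (PolySite.incl hΛ) (ladderWord (yw l))) +
        (∑ m' ∈ ah, ((dc m' : ℝ) : ℂ) • ((V m')ᴴ - V m') + ∑ k ∈ w, a k • ladderWord (word k))) :
    2 * (ω.expect (pairRegion (insert (0 : Site 2) unitSteps) 0) (localPairAt (insert (0 : Site 2) unitSteps) dWaveFormFactor 0)).re ≤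
      -(c - ∑ k ∈ w, ‖a k‖ + (∑ σ : Fin 2, μc σ) * (ω.density / 2 - ν)) := by
  have hmain := hω.re_sum_twistedFlipAct_expect_ge_of_sourced_certificate t' U μ h hΛ h0 hz _ κp κm u lo μc ν hcap hlo hΛm O
    tt γ wv fl mt hsh bb yw ah dc V w a word hcert
  simp_rw [map_neg, Complex.neg_re, re_expect_fermionEmbed_localPairAt_add_conjTranspose, Finset.sum_neg_distrib,
    ← Finset.mul_sum, ω.sum_re_expect_localPairAt_dWave_twistedFlipAct] at hmain
  linarith

/-- **RESPONSE-FLOOR shape** (`Xw = +(Γ P₀^d + (Γ P₀^d)ᴴ)`, the MIN program): the same rows prove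
`c − Σ‖aₖ‖ + (Σ_σ μ_σ)(ρ(ω)/2 − ν) ≤ 2 Re ω(P₀^d)` for every translation-invariant `ω` (recorded for completeness: in the
translation-invariant class such one-point floors are vacuous at small `h` — census (38) of the cell —, the informative floors
need ground-state rows). [cite: KomaTasaki1994, §1] [cite: WangEtAl2024, §III] -/
theorem IsTranslationInvariant.le_two_mul_re_expect_localPairAt_of_twistedFlip_certificate (hω : ω.IsTranslationInvariant)
    (t' U μ h : ℝ) {Λ Λ' : Finset (Site 2)} (hΛ : Λ ⊆ Λ') (h0 : thicken ({0} : Finset (Site 2)) 1 ⊆ Λ') (hz : (0 : Site 2) ∈ Λ')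
    (hP : pairRegion (insert (0 : Site 2) unitSteps) 0 ⊆ Λ')
    (κp κm u lo : ℝ) (μc : Fin 2 → ℝ) (ν : ℝ)
    (hcap : κp * ω.meanEnergy (hubbardTTPrimeSourcedInteraction 1 t' U μ dWaveFormFactor h) 1 ≤ κp * u)
    (hlo : ∀ σ : InfVolFermionState 2, σ.IsTranslationInvariant → σ.density = ω.density →
      κm * lo ≤ κm * σ.meanEnergy (hubbardTTPrimeFermionInteraction 1 t' U) 1)
    {m : Type*} [Fintype m] [DecidableEq m] {Λm : Matrix m m ℂ} (hΛm : Λm.PosSemidef) (O : m → FermionOp Λ')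
    {ι : Type*} (tt : Finset ι) (γ : ι → DihedralGroup 4) (wv : ι → Site 2) (fl mt : ι → Fin 2)
    (hsh : ∀ l, d4ShiftSet (γ l) (wv l) Λ ⊆ Λ') (bb : ι → ℂ) (yw : ι → List (Orb (PolySite Λ) × Bool))
    {δ : Type*} (ah : Finset δ) (dc : δ → ℝ) (V : δ → FermionOp Λ')
    {κ'' : Type*} (w : Finset κ'') (a : κ'' → ℂ) (word : κ'' → List (Orb (PolySite Λ') × Bool)) {c : ℝ}
    (hcert : (fermionEmbed (PolySite.incl hP) (localPairAt (insert (0 : Site 2) unitSteps) dWaveFormFactor 0) +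
          (fermionEmbed (PolySite.incl hP) (localPairAt (insert (0 : Site 2) unitSteps) dWaveFormFactor 0))ᴴ) -
        (c : ℂ) • (1 : FermionOp Λ') -
        ∑ σ : Fin 2, ((μc σ : ℝ) : ℂ) • (nAt 0 hz σ - ((ν : ℝ) : ℂ) • (1 : FermionOp Λ')) -
        ((κp : ℝ) : ℂ) • (((u : ℝ) : ℂ) • (1 : FermionOp Λ') -
          fermionEmbed (PolySite.incl h0) ((hubbardTTPrimeSourcedInteraction 1 t' U μ dWaveFormFactor h).meanEnergyObs 1)) -
        ((κm : ℝ) : ℂ) • (fermionEmbed (PolySite.incl h0) ((hubbardTTPrimeFermionInteraction 1 t' U).meanEnergyObs 1) -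
          ((lo : ℝ) : ℂ) • (1 : FermionOp Λ')) =
      gramForm Λm O +
        ∑ l ∈ tt, bb l • (gaugePhase (twistFlipExp (γ l) (fl l) (mt l)) (yw l) •
            fermionEmbed (PolySite.incl (hsh l))
              (fermionEmbed (PolySite.d4Emb (γ l) (wv l) Λ) (spinSwapIter (fl l).val (ladderWord (yw l)))) -
          fermionEmbed (PolySite.incl hΛ) (ladderWord (yw l))) +
        (∑ m' ∈ ah, ((dc m' : ℝ) : ℂ) • ((V m')ᴴ - V m') + ∑ k ∈ w, a k • ladderWord (word k))) :
    c - ∑ k ∈ w, ‖a k‖ + (∑ σ : Fin 2, μc σ) * (ω.density / 2 - ν) ≤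
      2 * (ω.expect (pairRegion (insert (0 : Site 2) unitSteps) 0) (localPairAt (insert (0 : Site 2) unitSteps) dWaveFormFactor 0)).re := by
  have hmain := hω.re_sum_twistedFlipAct_expect_ge_of_sourced_certificate t' U μ h hΛ h0 hz _ κp κm u lo μc ν hcap hlo hΛm O
    tt γ wv fl mt hsh bb yw ah dc V w a word hcert
  simp_rw [re_expect_fermionEmbed_localPairAt_add_conjTranspose, ← Finset.mul_sum,
    ω.sum_re_expect_localPairAt_dWave_twistedFlipAct] at hmain
  linarith

end InfVolFermionState

end Literature.MathematicalPhysics.QuantumLattice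

end
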